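import Summits.CriticalPhenomena.PercolationContinuityZ3.Theorems.Transplant.FKDoubleFanSeedCone
import Summits.CriticalPhenomena.PercolationContinuityZ3.Theorems.Transplant.FKDoubleFanOrbitCone
import Summits.CriticalPhenomena.PercolationContinuityZ3.Theorems.Transplant.FKDoubleFanCrossFar
import HarnessLib

/-!
# Double fans `K₂ ∨ P_{m+1}`: cross-apex negative correlation at ALL distances from any cone stable under the three polarisations

Helper file (`--supports stmt-CriticalPhenomena-4575`), FK sub-lane `prim-bschramm-fk-3` (gen 28); builds on p205010 (kernel theorem, internal
audit signed; external expert review pending).  No named facts, no sorries; standard axioms.  Memo `bschramm/prim-bschramm-fk-3/FAR-CROSS-III.md` §6–§8.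

The termwise route (`…DoubleFanWedge`, `…WedgeWord`) asked for a cone stable under six operators and the axis scalings, with sign conditions.  The seed
cone (`…SeedCone`) absorbs the three rank-one operators, the orbit cone (`…OrbitCone`) supplies the sign conditions, and the axis scalings are not needed
for the cross-apex word at all.  This file records the resulting MINIMAL criterion.  **`IsTStable₀`**: a convex cone of bivectors mapped into itself by
`T_D, T_a, T_b` — nothing else.  **`negCorr_spokes_cross_far_of_isTStable₀`**: if such a cone contains the inputs `u ∧ P_a u` (`u ∈ InKE q`) and pairs
non-negatively with the targets `s ∧ P_b s` (`s ∈ InKE q`), then for every weighted double fan and all `j < k ≤ m`,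
`φ(J_{a c_j} ∩ J_{b c_k}) ≤ φ(J_{a c_j}) φ(J_{b c_k})` (`0 < q ≤ 1`).  Algebra-level form: **`IsTStable₀.crossFar_rayleigh`** (= the hypothesis `halg` of
`negCorr_spokes_cross_far_of_inKE`).  Route: `K ↦ K ∩ orbitCone q ↦ (K ∩ orbitCone q) + seedCone q`, an axis-free operator cone
(**`IsOpCone₀`**, **`IsOpCone₀.wedgeH_midWord_mem`**, **`IsOpCone₀.rayleigh_word`**).
[cite: Grimmett2006, §3.9 eq. (3.94) (pp. 63–64)] [folklore]
-/

noncomputable section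

namespace Summit.CriticalPhenomena.PercolationContinuityZ3.Theorems

namespace FK

namespace ThreeApex

/-- A convex cone of bivectors mapped into itself by the three polarisations `T_D, T_a, T_b` (no axis scalings, no rank-one operators, no sign
conditions). [folklore] -/
@[folklore] structure IsTStable₀ (q : ℝ) (K : Set Biv) : Prop where
  /-- `0 ∈ K` -/
  zero_mem : (⟨0, 0, 0, 0, 0, 0, 0, 0, 0, 0⟩ : Biv) ∈ K
  /-- closed under sums -/
  add_mem : ∀ β γ, β ∈ K → γ ∈ K → Biv.add β γ ∈ K
  /-- closed under non-negative multiples -/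
  smul_mem : ∀ (a : ℝ) β, 0 ≤ a → β ∈ K → Biv.smul a β ∈ K
  /-- `T_D K ⊆ K` -/
  td : ∀ β, β ∈ K → opTD q β ∈ K
  /-- `T_a K ⊆ K` -/
  ta : ∀ β, β ∈ K → opTa β ∈ K
  /-- `T_b K ⊆ K` -/
  tb : ∀ β, β ∈ K → opTb β ∈ K

/-- An operator cone WITHOUT the axis scalings: a convex cone mapped into itself by `T_D, W_D, T_a, W_a, T_b, W_b`. [folklore] -/
@[folklore] structure IsOpCone₀ (q : ℝ) (K : Set Biv) : Prop where
  /-- `0 ∈ K` -/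
  zero_mem : (⟨0, 0, 0, 0, 0, 0, 0, 0, 0, 0⟩ : Biv) ∈ K
  /-- closed under sums -/
  add_mem : ∀ β γ, β ∈ K → γ ∈ K → Biv.add β γ ∈ K
  /-- closed under non-negative multiples -/
  smul_mem : ∀ (a : ℝ) β, 0 ≤ a → β ∈ K → Biv.smul a β ∈ K
  /-- `T_D K ⊆ K` -/
  td : ∀ β, β ∈ K → opTD q β ∈ K
  /-- `W_D K ⊆ K` -/
  wd : ∀ β, β ∈ K → opWD q β ∈ K
  /-- `T_a K ⊆ K` -/
  ta : ∀ β, β ∈ K → opTa β ∈ K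
  /-- `W_a K ⊆ K` -/
  wa : ∀ β, β ∈ K → opWa β ∈ K
  /-- `T_b K ⊆ K` -/
  tb : ∀ β, β ∈ K → opTb β ∈ K
  /-- `W_b K ⊆ K` -/
  wb : ∀ β, β ∈ K → opWb β ∈ K

namespace IsOpCone₀

variable {q : ℝ} {K : Set Biv}

/-- A three-term combination with non-negative coefficients of elements of `K` lies in `K`. [folklore] -/
theorem lin3_mem (hK : IsOpCone₀ q K) {a b c : ℝ} (ha : 0 ≤ a) (hb : 0 ≤ b) (hc : 0 ≤ c) {β γ δ : Biv}
    (hβ : β ∈ K) (hγ : γ ∈ K) (hδ : δ ∈ K) : Biv.lin3 a β b γ c δ ∈ K :=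
  hK.add_mem _ _ (hK.smul_mem a β ha hβ) (hK.add_mem _ _ (hK.smul_mem b γ hb hγ) (hK.smul_mem c δ hc hδ))

/-- Rim steps keep the pair bivector in the cone (`r ∈ [0,1]`). [folklore] -/
theorem wedgeH_rimStep_mem (hK : IsOpCone₀ q K) {r : ℝ} (hr0 : 0 ≤ r) (hr1 : r ≤ 1) {X Y : V5} (h : wedgeH X Y ∈ K) :
    wedgeH (rimStep q r X) (rimStep q r Y) ∈ K := by
  rw [wedgeH_rimStep]
  exact hK.lin3_mem (by positivity) (mul_nonneg hr0 (by linarith)) (by positivity) h (hK.td _ h) (hK.wd _ h)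

/-- `a`-spokes keep the pair bivector in the cone (`x ∈ [0,1]`). [folklore] -/
theorem wedgeH_conv_edgeAC_mem (hK : IsOpCone₀ q K) {x : ℝ} (hx0 : 0 ≤ x) (hx1 : x ≤ 1) {X Y : V5} (h : wedgeH X Y ∈ K) :
    wedgeH (conv (edgeAC x) X) (conv (edgeAC x) Y) ∈ K := by
  rw [wedgeH_conv_edgeAC]
  exact hK.lin3_mem (by positivity) (mul_nonneg hx0 (by linarith)) (by positivity) h (hK.ta _ h) (hK.wa _ h)

/-- `b`-spokes keep the pair bivector in the cone (`y ∈ [0,1]`). [folklore] -/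
theorem wedgeH_conv_edgeBC_mem (hK : IsOpCone₀ q K) {y : ℝ} (hy0 : 0 ≤ y) (hy1 : y ≤ 1) {X Y : V5} (h : wedgeH X Y ∈ K) :
    wedgeH (conv (edgeBC y) X) (conv (edgeBC y) Y) ∈ K := by
  rw [wedgeH_conv_edgeBC]
  exact hK.lin3_mem (by positivity) (mul_nonneg hy0 (by linarith)) (by positivity) h (hK.tb _ h) (hK.wb _ h)

/-- The middle word keeps the pair bivector in the cone. [folklore] -/
theorem wedgeH_midWord_mem (hK : IsOpCone₀ q K) :
    ∀ {mids : List (ℝ × ℝ × ℝ)}, UnitBlocks mids → ∀ {X Y : V5}, wedgeH X Y ∈ K → wedgeH (midWord q mids X) (midWord q mids Y) ∈ K := by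
  intro mids
  induction mids with
  | nil => intro _ X Y h; simpa [midWord] using h
  | cons blk rest ih =>
    intro hm X Y h
    have hb := hm blk (by simp)
    have hrest : UnitBlocks rest := fun b hb' => hm b (by simp [hb'])
    simp only [midWord]
    exact ih hrest (hK.wedgeH_conv_edgeAC_mem hb.2.2.1 hb.2.2.2.1
      (hK.wedgeH_conv_edgeBC_mem hb.2.2.2.2.1 hb.2.2.2.2.2 (hK.wedgeH_rimStep_mem hb.1 hb.2.1 h)))

/-- **The termwise route without axis scalings**: membership of the `u`-side pair bivector in an `IsOpCone₀` that pairs non-negatively with the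
`s`-side pair bivector gives the pinned Rayleigh inequality after every double-fan word. [folklore] -/
theorem rayleigh_word (hK : IsOpCone₀ q K) {mids : List (ℝ × ℝ × ℝ)} (hm : UnitBlocks mids) {rd : ℝ} (hrd0 : 0 ≤ rd) (hrd1 : rd ≤ 1)
    {X₀ X₁ Y₀ Y₁ : V5} (hu : wedgeH X₀ X₁ ∈ K) (hs : ∀ β, β ∈ K → 0 ≤ pairH q β (wedgeH Y₀ Y₁)) :
    val q (conv Y₁ (rimStep q rd (midWord q mids X₁))) * val q (conv Y₀ (rimStep q rd (midWord q mids X₀))) ≤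
      val q (conv Y₀ (rimStep q rd (midWord q mids X₁))) * val q (conv Y₁ (rimStep q rd (midWord q mids X₀))) := by
  have hmem : wedgeH (rimStep q rd (midWord q mids X₀)) (rimStep q rd (midWord q mids X₁)) ∈ K :=
    hK.wedgeH_rimStep_mem hrd0 hrd1 (hK.wedgeH_midWord_mem hm hu)
  have key := rayleigh_of_isOpCone hmem hs
  have e : ∀ X Y : V5, conv Y X = conv X Y := fun X Y => by simp only [← mul_def]; ac_rfl
  rw [e _ Y₁, e _ Y₀, e _ Y₀, e _ Y₁]
  linarith [key]

end IsOpCone₀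

/-! ### From a `T`-stable cone to an axis-free operator cone -/

namespace IsTStable₀

variable {q : ℝ} {K : Set Biv}

/-- **`(K ∩ orbitCone q) + seedCone q` is an axis-free operator cone** for every `T`-stable `K` (`0 ≤ q`): the polarisations act on both summands,
the orbit cone gives `β_yv, β_zv, ℓ_D(β) ≥ 0` on the first summand, so the rank-one operators send it into the seed cone. [folklore] -/
theorem isOpCone₀_sum (hK : IsTStable₀ q K) (hq0 : 0 ≤ q) : IsOpCone₀ q (sumSeed q (K ∩ orbitCone q)) where
  zero_mem := IsTCone.mem_sumSeed q ⟨hK.zero_mem, zero_mem_orbitCone q⟩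
  add_mem := by
    rintro β γ ⟨κ, hκ, σ, hσ, rfl⟩ ⟨κ', hκ', σ', hσ', rfl⟩
    refine ⟨Biv.add κ κ', ⟨hK.add_mem _ _ hκ.1 hκ'.1, orbitCone_add_mem hκ.2 hκ'.2⟩, Biv.add σ σ', seedCone_add_mem hσ hσ', ?_⟩
    ext <;> simp only [Biv.add] <;> ring
  smul_mem := by
    rintro t β ht ⟨κ, hκ, σ, hσ, rfl⟩
    refine ⟨Biv.smul t κ, ⟨hK.smul_mem _ _ ht hκ.1, orbitCone_smul_mem ht hκ.2⟩, Biv.smul t σ, seedCone_smul_mem ht hσ, ?_⟩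
    ext <;> simp only [Biv.add, Biv.smul] <;> ring
  td := by
    rintro β ⟨κ, hκ, σ, hσ, rfl⟩
    exact ⟨opTD q κ, ⟨hK.td _ hκ.1, orbitCone_opTD_mem hq0 hκ.2⟩, opTD q σ, seedCone_opTD_mem hq0 hσ, opTD_add q κ σ⟩
  wd := by
    rintro β ⟨κ, hκ, σ, hσ, rfl⟩
    refine ⟨_, ⟨hK.zero_mem, zero_mem_orbitCone q⟩, Biv.add (opWD q κ) (opWD q σ), seedCone_add_mem ?_ (seedCone_opWD_mem hq0 hσ),
      by rw [opWD_add, Biv.zero_add]⟩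
    rw [opWD_eq_smul]
    exact seedCone_smul_mem (orbitCone_signs hκ.2).2.2 (bivAB_mem_seedCone q)
  ta := by
    rintro β ⟨κ, hκ, σ, hσ, rfl⟩
    exact ⟨opTa κ, ⟨hK.ta _ hκ.1, orbitCone_opTa_mem hκ.2⟩, opTa σ, seedCone_opTa_mem hq0 hσ, opTa_add κ σ⟩
  wa := by
    rintro β ⟨κ, hκ, σ, hσ, rfl⟩
    refine ⟨_, ⟨hK.zero_mem, zero_mem_orbitCone q⟩, Biv.add (opWa κ) (opWa σ), seedCone_add_mem ?_ (seedCone_opWa_mem hq0 hσ),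
      by rw [opWa_add, Biv.zero_add]⟩
    rw [opWa_eq_smul]
    exact seedCone_smul_mem (orbitCone_signs hκ.2).1 (bivYV_mem_seedCone q)
  tb := by
    rintro β ⟨κ, hκ, σ, hσ, rfl⟩
    exact ⟨opTb κ, ⟨hK.tb _ hκ.1, orbitCone_opTb_mem hq0 hκ.2⟩, opTb σ, seedCone_opTb_mem hσ, opTb_add κ σ⟩
  wb := by
    rintro β ⟨κ, hκ, σ, hσ, rfl⟩
    refine ⟨_, ⟨hK.zero_mem, zero_mem_orbitCone q⟩, Biv.add (opWb κ) (opWb σ), seedCone_add_mem ?_ (seedCone_opWb_mem hq0 hσ),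
      by rw [opWb_add, Biv.zero_add]⟩
    rw [opWb_eq_smul]
    exact seedCone_smul_mem (orbitCone_signs hκ.2).2.1 (bivZV_mem_seedCone q)

/-- **The algebra-level Rayleigh inequality at every distance from a `T`-stable cone** (the hypothesis `halg` of `negCorr_spokes_cross_far_of_inKE`).
[folklore] -/
theorem crossFar_rayleigh (hK : IsTStable₀ q K) (hq0 : 0 ≤ q) (hq1 : q ≤ 1)
    (hin : ∀ u, InKE q u → wedgeH (conv (edgeAC 0) u) (conv (edgeAC 1) u) ∈ K)
    (hpos : ∀ β, β ∈ K → ∀ s, InKE q s → 0 ≤ pairH q β (wedgeH (conv (edgeBC 0) s) (conv (edgeBC 1) s))) :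
    ∀ (mids : List (ℝ × ℝ × ℝ)), UnitBlocks mids → ∀ rd : ℝ, 0 ≤ rd → rd ≤ 1 → ∀ u s : V5, InKE q u → InKE q s →
      0 ≤ crossFarZ q mids rd u s 1 0 * crossFarZ q mids rd u s 0 1 - crossFarZ q mids rd u s 1 1 * crossFarZ q mids rd u s 0 0 := by
  intro mids hm rd hrd0 hrd1 u s hu hs
  have hO := hK.isOpCone₀_sum hq0
  have hmem : wedgeH (conv (edgeAC 0) u) (conv (edgeAC 1) u) ∈ sumSeed q (K ∩ orbitCone q) :=
    IsTCone.mem_sumSeed q ⟨hin u hu, wedgeH_mem_orbitCone hq0 hq1 hu⟩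
  have hposS : ∀ β, β ∈ sumSeed q (K ∩ orbitCone q) → 0 ≤ pairH q β (wedgeH (conv (edgeBC 0) s) (conv (edgeBC 1) s)) :=
    IsTCone.pairH_sum_crossB_nonneg (K := K ∩ orbitCone q) hq0 hq1 hs (fun β hβ => hpos β hβ.1 s hs)
  have key := hO.rayleigh_word hm hrd0 hrd1 hmem hposS
  have e : ∀ (τ : ℝ) (X : V5), conv s (conv (edgeBC τ) X) = conv (conv (edgeBC τ) s) X := by
    intro τ X; simp only [← mul_def]; ac_rfl
  simp only [crossFarZ, e]
  nlinarith [key]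

end IsTStable₀

/-- A `T`-stable cone in the sense of `…OrbitCone` (with axis scalings) is in particular `T`-stable in the present minimal sense. [folklore] -/
theorem IsTStable.toIsTStable₀ {q : ℝ} {K : Set Biv} (hK : IsTStable q K) : IsTStable₀ q K :=
  ⟨hK.zero_mem, hK.add_mem, hK.smul_mem, hK.td, hK.ta, hK.tb⟩

open MeasureTheory Literature.Probability.LatticeModels Literature.Probability.Percolation
open scoped Classical

variable {V : Type*} [Fintype V]
variable {a b : V} {c : ℕ → V} {m : ℕ}
variable (hab : a ≠ b) (hinj : ∀ j k, j ≤ m → k ≤ m → c j = c k → j = k) (hca : ∀ j, j ≤ m → c j ≠ a) (hcb : ∀ j, j ≤ m → c j ≠ b)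
include hab hinj hca hcb

/-- **CROSS-APEX NEGATIVE CORRELATION AT ALL DISTANCES FROM A CONE STABLE UNDER THE THREE POLARISATIONS.**  If some convex cone of bivectors is
mapped into itself by `T_D, T_a, T_b`, contains every input `u ∧ P_a u` (`u ∈ InKE q`) and pairs non-negatively with every target `s ∧ P_b s`
(`s ∈ InKE q`), then for every weighted double fan (`card V = m + 3`, `0 < q ≤ 1`) and all `j < k ≤ m`:
`φ(J_{a c_j} ∩ J_{b c_k}) ≤ φ(J_{a c_j})·φ(J_{b c_k})`. [folklore] -/
theorem negCorr_spokes_cross_far_of_isTStable₀ (hcard : Fintype.card V = m + 3) {q : ℝ} (hq0 : 0 < q) (hq1 : q ≤ 1)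
    (w : Sym2 V → unitInterval) (hsupp : ∀ e, e ∉ dfPairs a b c m → w e = 0) {K : Set Biv} (hK : IsTStable₀ q K)
    (hin : ∀ u, InKE q u → wedgeH (conv (edgeAC 0) u) (conv (edgeAC 1) u) ∈ K)
    (hpos : ∀ β, β ∈ K → ∀ s, InKE q s → 0 ≤ pairH q β (wedgeH (conv (edgeBC 0) s) (conv (edgeBC 1) s)))
    {j k : ℕ} (hjk : j < k) (hk : k ≤ m) :
    (rcMeasureW w q ∅).real ({ω : BondConfig V | s(a, c j) ∈ ω} ∩ {ω | s(b, c k) ∈ ω}) ≤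
      (rcMeasureW w q ∅).real {ω : BondConfig V | s(a, c j) ∈ ω} * (rcMeasureW w q ∅).real {ω : BondConfig V | s(b, c k) ∈ ω} :=
  negCorr_spokes_cross_far_of_inKE hab hinj hca hcb hcard hq0 w hsupp (hK.crossFar_rayleigh hq0.le hq1 hin hpos) hjk hk

end ThreeApex

end FK

end Summit.CriticalPhenomena.PercolationContinuityZ3.Theorems
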